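import Summits.QuantumFields.QCD.Theses.QuarksNoInfraredClause
import Summits.QuantumFields.QCD.Theses.DiagonalSpine
import Literature.MathematicalPhysics.QuantumFieldTheory.QCDFlavourSymmetry
import Literature.MathematicalPhysics.QuantumFieldTheory.QCDGoldstoneBound
import HarnessLib

/-!
# Line `registered` of crux `ThinQCD` (item stmt-QuantumFields-17278, route
route-QuantumFields-QuarksNoInfraredClause): the lattice anchor S1 bracketed by EXISTING items

The registered stub `stub_latticeAnchor` (S1, skeleton r2 of `Cruxes/ThinQCD/Lines/birth.lean`) asks, for
`N_f = 2, 3`, for ONE mass-independent regularisation `reg` with leading-log mass scaling, the eventual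
Goldstone lower bound (`QCDRegularisation.HasGoldstoneBound`), two-loop asymptotic scaling and, at EVERY
positive mass tuple, the physical branch together with a volume-uniform lattice gap in the FLAVOUR-NEUTRAL
sector (`QCDScheme.HasNeutralLatticeMassGap`).  This file proves no part of it; it places it exactly among
the open items of the sibling route `DiagonalSpine` and this route's other crux:

* `latticeAnchor_of_diagonalSpine` — `FullLatticeGap → LightQuarkGap → ChiralTuning → S1`: the consequent of
  `DiagonalSpine.ChiralTuning` (items stmt-QuantumFields-8928 → 14656 → 17436) is a regularisation with
  H1 (mass scaling), H2 (asymptotic scaling), H3 (physical branch + FULL lattice gap at every positive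
  tuple), H4 (lattice non-decoupling) and G (the eventual Goldstone lower bound, verbatim
  `QCDRegularisation.hasGoldstoneBound_iff`); dropping H4 and restricting the gap to the neutral sector
  (`HasLatticeMassGap.neutral`) gives S1 verbatim.  So S1 is implied by three EXISTING open cruxes — it
  needs no new item.
* `fullLatticeGap_of_torusHalfSpectrum_of_latticeAnchor` — `TorusHalfSpectrum → S1 → FullLatticeGap`: with
  this route's half-spectrum crux (stmt-QuantumFields-9508) the neutral gap `Δ₀(m)` of S1 is a full lattice
  gap `Δ₀(m)/2`, i.e. S1 gives back `DiagonalSpine.FullLatticeGap` (the Goldstone clause is simply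
  dropped).  Hence, modulo `TorusHalfSpectrum`, S1 sits between `FullLatticeGap ∧ LightQuarkGap ∧
  ChiralTuning` and `FullLatticeGap`.

No definition, no named fact, no `sorry`.
-/

noncomputable section

namespace Summit.QuantumFields.QCD.Cruxes.ThinQCD.Registered

open scoped Topology
open Filter
open Literature.MathematicalPhysics.QuantumFieldTheory
open Summit.QuantumFields.QCD.Theses

/-- **S1 from the `DiagonalSpine` chain.**  `FullLatticeGap` feeds `LightQuarkGap`, whose consequent feeds
`ChiralTuning`; its consequent carries mass scaling, asymptotic scaling, the physical branch and a FULL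
lattice gap at every positive tuple, lattice non-decoupling (unused here) and the eventual Goldstone lower
bound, which IS `reg.HasGoldstoneBound` (`QCDRegularisation.hasGoldstoneBound_iff`, definitional); the full
gap restricts to the neutral sector (`HasLatticeMassGap.neutral`).  The conclusion is VERBATIM the
registered signature of `stub_latticeAnchor` (skeleton r2). [folklore] -/
theorem latticeAnchor_of_diagonalSpine :
    DiagonalSpine.FullLatticeGap → DiagonalSpine.LightQuarkGap → DiagonalSpine.ChiralTuning →
      ∀ Nf : ℕ, Nf = 2 ∨ Nf = 3 → ∃ reg : QCDRegularisation Nf,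
        reg.HasMassScaling ∧ reg.HasGoldstoneBound ∧ (reg.scheme 0 0 0).HasAsymptoticScaling ∧
          ∀ m : Fin Nf → ℝ, (∀ f, 0 < m f) →
            (∀ f, ∀ᶠ k in atTop, (-1 : ℝ) < (reg.scheme m 0 0).mq f k) ∧
              ∃ Δ₀ : ℝ, 0 < Δ₀ ∧ (reg.scheme m 0 0).HasNeutralLatticeMassGap Δ₀ := by
  intro hF hL hC Nf hNf
  obtain ⟨reg, h1, h2, h3, -, hG⟩ := hC Nf hNf (hL Nf hNf (hF Nf hNf))
  refine ⟨reg, h1, (QCDRegularisation.hasGoldstoneBound_iff reg).2 hG, h2, fun m hm => ?_⟩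
  obtain ⟨hbr, Δ, hΔ, hgap⟩ := h3 m hm
  exact ⟨hbr, Δ, hΔ, hgap.neutral⟩

/-- **S1 gives back `FullLatticeGap` under the half-spectrum crux.**  For the regularisation of S1 and a
positive tuple `m`, the scheme `reg.scheme m 0 0` scales asymptotically (the clause reads only `β_k, a_k`,
shared with `reg.scheme 0 0 0`), its bare masses are eventually on the physical branch, and its neutral
lattice gap `Δ₀` is a neutral gap `2 · (Δ₀/2)` (`HasNeutralLatticeMassGap.mono`), which `TorusHalfSpectrum`
(fed `0 < Δ₀/2` and `0 < b₀(N_f)` for `N_f = 2, 3`) turns into the full lattice gap `Δ₀/2`. [folklore] -/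
theorem fullLatticeGap_of_torusHalfSpectrum_of_latticeAnchor :
    QuarksNoInfraredClause.TorusHalfSpectrum →
      (∀ Nf : ℕ, Nf = 2 ∨ Nf = 3 → ∃ reg : QCDRegularisation Nf,
        reg.HasMassScaling ∧ reg.HasGoldstoneBound ∧ (reg.scheme 0 0 0).HasAsymptoticScaling ∧
          ∀ m : Fin Nf → ℝ, (∀ f, 0 < m f) →
            (∀ f, ∀ᶠ k in atTop, (-1 : ℝ) < (reg.scheme m 0 0).mq f k) ∧
              ∃ Δ₀ : ℝ, 0 < Δ₀ ∧ (reg.scheme m 0 0).HasNeutralLatticeMassGap Δ₀) →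
        DiagonalSpine.FullLatticeGap := by
  intro hH hA Nf hNf
  obtain ⟨reg, h1, -, h2, h3⟩ := hA Nf hNf
  refine ⟨reg, h1, h2, fun m hm => ?_⟩
  obtain ⟨hbr, Δ₀, hΔ₀, hgap⟩ := h3 m hm
  have hb : 0 < betaCoeff₀ Nf := by
    rcases hNf with rfl | rfl <;>
      · unfold Literature.MathematicalPhysics.QuantumFieldTheory.betaCoeff₀; positivity
  have has : (reg.scheme m 0 0).HasAsymptoticScaling := by
    obtain ⟨Λ, hΛ, ht⟩ := h2
    exact ⟨Λ, hΛ, ht⟩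
  have h2Δ : (reg.scheme m 0 0).HasNeutralLatticeMassGap (2 * (Δ₀ / 2)) := hgap.mono (by linarith)
  refine ⟨hbr, Δ₀ / 2, by positivity, hH Nf (reg.scheme m 0 0) (Δ₀ / 2) (by positivity) hb has hbr ?_⟩
  intro R R' A B hAn hBn
  exact h2Δ R R' A B hAn hBn

/-! ## Brackets for the reshaped anchor (skeleton r3/r4, continuation lead c1, 2026-08-17)

Since reshape r3 the registered `stub_latticeAnchor` carries the chiral clause in the crux's own form
`reg.IsChiralAtZero` (instead of the Goldstone bound) and keeps the NEUTRAL lattice gap at every positive tuple: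

  `∀ Nf, Nf = 2 ∨ Nf = 3 → ∃ reg, reg.HasMassScaling ∧ reg.IsChiralAtZero ∧ (reg.scheme 0 0 0).HasAsymptoticScaling ∧
     ∀ m > 0, (∀ f, ∀ᶠ k, −1 < (reg.scheme m 0 0).mq f k) ∧ ∃ Δ₀ > 0, (reg.scheme m 0 0).HasNeutralLatticeMassGap Δ₀`.

It is implied by the r2 anchor (`HasGoldstoneBound.isChiralAtZero`), hence by the `DiagonalSpine` chain; and WITH this
route's `TorusHalfSpectrum` it is EQUIVALENT to the chiral lattice half — the antecedent of
`CounterexampleMustBeHot.ChiralContinuumComplement` (stmt-QuantumFields-17304) and the hypothesis packet of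
`CounterexampleMustBeHot.ChiralCalibratedConvergence` (stmt-QuantumFields-18044), which the r4 composition feeds. -/

/-- **r2 anchor ⇒ r3/r4 anchor**: the Goldstone bound implies chirality at zero; everything else is identical. [folklore] -/
theorem latticeAnchorR3_of_latticeAnchorR2 :
    (∀ Nf : ℕ, Nf = 2 ∨ Nf = 3 → ∃ reg : QCDRegularisation Nf,
      reg.HasMassScaling ∧ reg.HasGoldstoneBound ∧ (reg.scheme 0 0 0).HasAsymptoticScaling ∧
        ∀ m : Fin Nf → ℝ, (∀ f, 0 < m f) →
          (∀ f, ∀ᶠ k in atTop, (-1 : ℝ) < (reg.scheme m 0 0).mq f k) ∧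
            ∃ Δ₀ : ℝ, 0 < Δ₀ ∧ (reg.scheme m 0 0).HasNeutralLatticeMassGap Δ₀) →
    ∀ Nf : ℕ, Nf = 2 ∨ Nf = 3 → ∃ reg : QCDRegularisation Nf,
      reg.HasMassScaling ∧ reg.IsChiralAtZero ∧ (reg.scheme 0 0 0).HasAsymptoticScaling ∧
        ∀ m : Fin Nf → ℝ, (∀ f, 0 < m f) →
          (∀ f, ∀ᶠ k in atTop, (-1 : ℝ) < (reg.scheme m 0 0).mq f k) ∧
            ∃ Δ₀ : ℝ, 0 < Δ₀ ∧ (reg.scheme m 0 0).HasNeutralLatticeMassGap Δ₀ := by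
  intro h Nf hNf
  obtain ⟨reg, h1, hG, h2, h3⟩ := h Nf hNf
  exact ⟨reg, h1, hG.isChiralAtZero, h2, h3⟩

/-- **The r3/r4 anchor from the `DiagonalSpine` chain** (`FullLatticeGap → LightQuarkGap → ChiralTuning`, items
stmt-QuantumFields-8928 / 14656 / 17436), through the r2 bracket. [folklore] -/
theorem latticeAnchorR3_of_diagonalSpine :
    DiagonalSpine.FullLatticeGap → DiagonalSpine.LightQuarkGap → DiagonalSpine.ChiralTuning →
      ∀ Nf : ℕ, Nf = 2 ∨ Nf = 3 → ∃ reg : QCDRegularisation Nf,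
        reg.HasMassScaling ∧ reg.IsChiralAtZero ∧ (reg.scheme 0 0 0).HasAsymptoticScaling ∧
          ∀ m : Fin Nf → ℝ, (∀ f, 0 < m f) →
            (∀ f, ∀ᶠ k in atTop, (-1 : ℝ) < (reg.scheme m 0 0).mq f k) ∧
              ∃ Δ₀ : ℝ, 0 < Δ₀ ∧ (reg.scheme m 0 0).HasNeutralLatticeMassGap Δ₀ :=
  fun hF hL hC => latticeAnchorR3_of_latticeAnchorR2 (latticeAnchor_of_diagonalSpine hF hL hC)

/-- **With HALF the thin anchor IS the chiral lattice half** (direction thin ⇒ full): `TorusHalfSpectrum` turns the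
neutral gap `Δ₀ = 2·(Δ₀/2)` of `reg.scheme m 0 0` (asymptotically scaling, on the physical branch, `b₀(N_f) > 0` for
`N_f = 2, 3`) into the full lattice gap `Δ₀/2`; the other clauses are copied.  The conclusion is VERBATIM the antecedent of
`CounterexampleMustBeHot.ChiralContinuumComplement` / the hypothesis packet of `ChiralCalibratedConvergence`. [folklore] -/
theorem chiralLatticeHalf_of_torusHalfSpectrum_of_latticeAnchorR3 :
    QuarksNoInfraredClause.TorusHalfSpectrum →
      (∀ Nf : ℕ, Nf = 2 ∨ Nf = 3 → ∃ reg : QCDRegularisation Nf,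
        reg.HasMassScaling ∧ reg.IsChiralAtZero ∧ (reg.scheme 0 0 0).HasAsymptoticScaling ∧
          ∀ m : Fin Nf → ℝ, (∀ f, 0 < m f) →
            (∀ f, ∀ᶠ k in atTop, (-1 : ℝ) < (reg.scheme m 0 0).mq f k) ∧
              ∃ Δ₀ : ℝ, 0 < Δ₀ ∧ (reg.scheme m 0 0).HasNeutralLatticeMassGap Δ₀) →
      ∀ Nf : ℕ, Nf = 2 ∨ Nf = 3 → ∃ reg : QCDRegularisation Nf,
        reg.HasMassScaling ∧ reg.IsChiralAtZero ∧ (reg.scheme 0 0 0).HasAsymptoticScaling ∧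
          ∀ m : Fin Nf → ℝ, (∀ f, 0 < m f) →
            (∀ f, ∀ᶠ k in Filter.atTop, -1 < (reg.scheme m 0 0).mq f k) ∧
              ∃ Δ > 0, (reg.scheme m 0 0).HasLatticeMassGap Δ := by
  intro hH hA Nf hNf
  obtain ⟨reg, h1, hχ, h2, h3⟩ := hA Nf hNf
  refine ⟨reg, h1, hχ, h2, fun m hm => ?_⟩
  obtain ⟨hbr, Δ₀, hΔ₀, hgap⟩ := h3 m hm
  have hb : 0 < betaCoeff₀ Nf := by
    rcases hNf with rfl | rfl <;>
      · unfold Literature.MathematicalPhysics.QuantumFieldTheory.betaCoeff₀; positivity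
  have has : (reg.scheme m 0 0).HasAsymptoticScaling := by
    obtain ⟨Λ, hΛ, ht⟩ := h2
    exact ⟨Λ, hΛ, ht⟩
  have h2Δ : (reg.scheme m 0 0).HasNeutralLatticeMassGap (2 * (Δ₀ / 2)) := hgap.mono (by linarith)
  refine ⟨hbr, Δ₀ / 2, by positivity, hH Nf (reg.scheme m 0 0) (Δ₀ / 2) (by positivity) hb has hbr ?_⟩
  intro R R' A B hAn hBn
  exact h2Δ R R' A B hAn hBn

/-- **The chiral lattice half implies the thin anchor** (direction full ⇒ thin, no HALF needed): the full lattice gap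
restricts to the neutral sector (`HasLatticeMassGap.neutral`).  With the previous theorem: under `TorusHalfSpectrum`
the r3/r4 anchor and the chiral lattice half are EQUIVALENT. [folklore] -/
theorem latticeAnchorR3_of_chiralLatticeHalf :
    (∀ Nf : ℕ, Nf = 2 ∨ Nf = 3 → ∃ reg : QCDRegularisation Nf,
      reg.HasMassScaling ∧ reg.IsChiralAtZero ∧ (reg.scheme 0 0 0).HasAsymptoticScaling ∧
        ∀ m : Fin Nf → ℝ, (∀ f, 0 < m f) →
          (∀ f, ∀ᶠ k in Filter.atTop, -1 < (reg.scheme m 0 0).mq f k) ∧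
            ∃ Δ > 0, (reg.scheme m 0 0).HasLatticeMassGap Δ) →
    ∀ Nf : ℕ, Nf = 2 ∨ Nf = 3 → ∃ reg : QCDRegularisation Nf,
      reg.HasMassScaling ∧ reg.IsChiralAtZero ∧ (reg.scheme 0 0 0).HasAsymptoticScaling ∧
        ∀ m : Fin Nf → ℝ, (∀ f, 0 < m f) →
          (∀ f, ∀ᶠ k in atTop, (-1 : ℝ) < (reg.scheme m 0 0).mq f k) ∧
            ∃ Δ₀ : ℝ, 0 < Δ₀ ∧ (reg.scheme m 0 0).HasNeutralLatticeMassGap Δ₀ := by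
  intro h Nf hNf
  obtain ⟨reg, h1, hχ, h2, h3⟩ := h Nf hNf
  refine ⟨reg, h1, hχ, h2, fun m hm => ?_⟩
  obtain ⟨hbr, Δ, hΔ, hgap⟩ := h3 m hm
  exact ⟨hbr, Δ, hΔ, hgap.neutral⟩

end Summit.QuantumFields.QCD.Cruxes.ThinQCD.Registered

end
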